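import Literature.Analysis.FluidPDE.TransportGalerkinLimit
import Literature.Analysis.FunctionSpaces.TorusAxisAverageCalculus
import Literature.Analysis.FunctionSpaces.TorusFourierCalculus
import Literature.Analysis.FunctionSpaces.TorusWeakFormBookkeeping
import HarnessLib

/-!
# The Fourier–Galerkin scheme for the linear transport equation on `T^d`, IV: the tested
  identities and the passage to the limit in the weak formulation

Analysis/FluidPDE proof-support file, fourth of the discharge of
`Torus.BardosTitiWiedemann2012_transportExistence` (`TransportWeakExistence`; Bardos–Titi–Wiedemann
2012, proof of Cor. 2; DiPerna–Lions 1989, Prop. II.1) for velocities weakly continuous into `L²`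
(`TransportGalerkin`, `TransportGalerkinScheme`, `TransportGalerkinLimit`). Contents, all proved:

* the Galerkin field tested against an arbitrary real trigonometric polynomial,
  `∑_k conj(a_k) G(v,c)_k = ∫ w_c ⟪v, ∇p_a⟫` (`sum_conj_mul_transportGalerkinRHS_eq_integral`), and
  its continuity in time along a continuous coefficient curve for a weakly continuous velocity
  (`continuousOn_transportGalerkinRHS_comp`);
* test functions: time derivatives of Fourier coefficients
  (`hasDerivAt_mFourierCoeff_ofReal_slice`), truncation commutes with derivatives
  (`partialDeriv_scalarTruncate`), `L²` convergence of truncated gradients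
  (`tendsto_integral_norm_sq_gradient_sub_scalarTruncate`) and Bessel for them
  (`integral_norm_sq_gradient_scalarTruncate_le`);
* **the tested Galerkin identity of order `N`, integrated in time**
  (`galerkin_tested_identity`): for a scalar test function `ψ` vanishing for `t ≥ T₁ ≥ 0`,
  `∫₀^{T₁} (∫ W_N ∂ₜψ + ∫ W_N ⟪b, ∇P_N ψ⟫) dt + ∫ P_N w₀ ψ(0) = 0` (product rule on the
  coefficient pairing `∫ W_N ψ = ∑_k Re(α_k 𝓕ψ(-k))`, the Galerkin equations, fundamental theorem
  of calculus), with the continuity in time of both tested terms;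
* **the weak transport identity of a Galerkin limit** (`IsGalerkinLimit.weak_eq`): for an
  essentially bounded velocity (a.e. in time) the identities pass to the limit along the
  subsequence — weak convergence of the slices, strong `L²` convergence of `∇P_N ψ` and `P_N w₀`,
  dominated convergence in time (Robinson–Rodrigo–Sadowski 2016, proof of Thm. 4.4, Step 4, linear
  terms) — giving `∫₀ᵀ ∫ w (∂ₜψ + ⟪b, ∇ψ⟫ + 0·Δψ) + ∫ w₀ ψ(0) = 0` for every test function on `[0,T)`.

The assembly of `IsWeakScalarTransportOn` and the every-`t` extras is the subject of the sequel.

## References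

* C. Bardos, E. S. Titi, E. Wiedemann, C. R. Math. Acad. Sci. Paris 350 (2012) 757–760, proof of
  Cor. 2 (`BardosTitiWiedemann2012`).
* R. J. DiPerna, P.-L. Lions, Invent. Math. 98 (1989) 511–547, Prop. II.1 (`DiPernaLions1989Invent`).
* J. C. Robinson, J. L. Rodrigo, W. Sadowski, *The three-dimensional Navier–Stokes equations*
  (CUP 2016), (4.5) and proof of Thm. 4.4 (`RobinsonRodrigoSadowski2016`).
-/

open MeasureTheory Set Filter Topology Function UnitAddTorus Metric
open scoped NNReal InnerProductSpace ComplexConjugate ContDiff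

noncomputable section

namespace Literature.Analysis.FluidPDE

namespace Torus

open Literature.Analysis.FunctionSpaces.Torus Literature.Analysis.FunctionSpaces

variable {d : Type*} [Fintype d] [DecidableEq d]

/-! ## The Galerkin field tested against an arbitrary real trigonometric polynomial -/

section Tested

variable {S : Finset (d → ℤ)}

/-- **The Galerkin field tested against a real coefficient vector**: for real `a` on a symmetric
`S`, any `c`, and an integrable velocity `v`,
`∑_k conj(a_k) G(v, c)_k = ∫ w_c ⟪v, ∇p_a⟫` with `w_c = galerkinPoly S c`, `p_a = galerkinPoly S a`
(the weak form of `-div (v w_c)` tested with `p_a`; for `a = c` and divergence-free `v` this is the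
energy identity of part I). [folklore] -/
theorem sum_conj_mul_transportGalerkinRHS_eq_integral (hS : ∀ k ∈ S, -k ∈ S) {a : ↥S → ℂ}
    (ha : IsRealScalarCoeff a) (c : ↥S → ℂ) {v : UnitAddTorus d → EuclideanSpace ℝ d} (hv : Integrable v volume) :
    ∑ k : ↥S, conj (a k) * transportGalerkinRHS S v c k =
      ((∫ x, galerkinPoly S c x * ⟪v x, FunctionSpaces.Torus.gradient (galerkinPoly S a) x⟫_ℝ : ℝ) : ℂ) := by
  set w := galerkinPoly S c with hw
  set p := galerkinPoly S a with hp
  have hint : ∀ (k : ↥S) (j : d), Integrable (fun x => mFourier (-(k : d → ℤ)) x • ((w x * v x j : ℝ) : ℂ)) volume :=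
    fun k j => integrable_mFourier_smul' (integrable_ofReal_galerkinPoly_mul hv c j) _
  have hsummand : ∀ (k : ↥S) (j : d), Integrable (fun x => ((w x * v x j : ℝ) : ℂ) *
      (conj (a k) * ((-(2 * Real.pi * Complex.I) * (((k : d → ℤ) j : ℝ) : ℂ)) * mFourier (-(k : d → ℤ)) x))) volume :=
    fun k j => ((hint k j).const_mul (conj (a k) * (-(2 * Real.pi * Complex.I) * (((k : d → ℤ) j : ℝ) : ℂ)))).congr
      (ae_of_all _ fun x => by simp only [smul_eq_mul]; ring)
  -- Step 1: each `conj(a_k) G_k` as one integral of a finite sum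
  have h1 : ∀ k : ↥S, conj (a k) * transportGalerkinRHS S v c k =
      ∫ x, ∑ j, ((w x * v x j : ℝ) : ℂ) *
        (conj (a k) * ((-(2 * Real.pi * Complex.I) * (((k : d → ℤ) j : ℝ) : ℂ)) * mFourier (-(k : d → ℤ)) x)) := by
    intro k
    simp only [transportGalerkinRHS]
    rw [Finset.mul_sum, Finset.mul_sum, integral_finsetSum _ fun j _ => hsummand k j]
    refine Finset.sum_congr rfl fun j _ => ?_
    rw [mFourierCoeff_eq_integral_volume,
      show (∫ x, ((w x * v x j : ℝ) : ℂ) *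
          (conj (a k) * ((-(2 * Real.pi * Complex.I) * (((k : d → ℤ) j : ℝ) : ℂ)) * mFourier (-(k : d → ℤ)) x))) =
        (conj (a k) * (-(2 * Real.pi * Complex.I) * (((k : d → ℤ) j : ℝ) : ℂ))) *
          ∫ x, mFourier (-(k : d → ℤ)) x • ((w x * v x j : ℝ) : ℂ) from by
        rw [← integral_const_mul]
        exact integral_congr_ae (ae_of_all _ fun x => by simp only [smul_eq_mul]; ring)]
    ring
  -- Step 2: sum over `k` and recognise `∂ⱼ p`
  have h2 : ∑ k : ↥S, conj (a k) * transportGalerkinRHS S v c k =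
      ∫ x, ∑ j, ((w x * v x j : ℝ) : ℂ) * ((FunctionSpaces.Torus.partialDeriv j p x : ℝ) : ℂ) := by
    simp_rw [h1]
    rw [← integral_finsetSum _ fun k _ => integrable_finsetSum _ fun j _ => hsummand k j]
    refine integral_congr_ae (ae_of_all _ fun x => ?_)
    show ∑ k : ↥S, ∑ j, ((w x * v x j : ℝ) : ℂ) *
        (conj (a k) * ((-(2 * Real.pi * Complex.I) * (((k : d → ℤ) j : ℝ) : ℂ)) * mFourier (-(k : d → ℤ)) x)) =
      ∑ j, ((w x * v x j : ℝ) : ℂ) * ((FunctionSpaces.Torus.partialDeriv j p x : ℝ) : ℂ)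
    rw [Finset.sum_comm]
    refine Finset.sum_congr rfl fun j _ => ?_
    rw [← Finset.mul_sum, sum_conj_mul_mFourier_neg hS ha j x]
  -- Step 3: the real form
  have h3 : ∀ x, ∑ j, ((w x * v x j : ℝ) : ℂ) * ((FunctionSpaces.Torus.partialDeriv j p x : ℝ) : ℂ) =
      ((w x * ⟪v x, FunctionSpaces.Torus.gradient p x⟫_ℝ : ℝ) : ℂ) := by
    intro x
    rw [PiLp.inner_apply, Finset.mul_sum]
    push_cast
    refine Finset.sum_congr rfl fun j _ => ?_
    have hg : FunctionSpaces.Torus.gradient p x j = FunctionSpaces.Torus.partialDeriv j p x := gradient_reTrigPoly_apply _ _ x j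
    rw [RCLike.inner_apply, conj_trivial, hg]
    push_cast
    ring
  rw [h2]
  simp_rw [h3]
  rw [integral_complex_ofReal]

/-- Real-part form of the tested identity. [folklore] -/
theorem re_sum_conj_mul_transportGalerkinRHS_eq_integral (hS : ∀ k ∈ S, -k ∈ S) {a : ↥S → ℂ}
    (ha : IsRealScalarCoeff a) (c : ↥S → ℂ) {v : UnitAddTorus d → EuclideanSpace ℝ d} (hv : Integrable v volume) :
    (∑ k : ↥S, conj (a k) * transportGalerkinRHS S v c k).re =
      ∫ x, galerkinPoly S c x * ⟪v x, FunctionSpaces.Torus.gradient (galerkinPoly S a) x⟫_ℝ := by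
  rw [sum_conj_mul_transportGalerkinRHS_eq_integral hS ha c hv, Complex.ofReal_re]

end Tested

/-! ## Continuity in time of the Galerkin field along a continuous coefficient curve -/

section AlongCurve

variable {S : Finset (d → ℤ)}

/-- **Joint continuity in time along a curve**: if `α` is continuous on `[0,T]`, `b` has integrable
slices with `∫ ‖b t‖ ≤ B'` there and is weakly continuous into `L²`, then
`t ↦ G(b(t), α(t))` is continuous on `[0,T]` (Lipschitz in the coefficient uniformly in time plus
continuity in time at fixed coefficient). [folklore] -/
theorem continuousOn_transportGalerkinRHS_comp {T : ℝ} {b : ℝ → UnitAddTorus d → EuclideanSpace ℝ d}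
    (hb1 : ∀ t ∈ Icc 0 T, Integrable (b t) volume) {B' : ℝ} (hB' : ∀ t ∈ Icc 0 T, ∫ x, ‖b t x‖ ≤ B')
    (hbc : ∀ g : UnitAddTorus d → EuclideanSpace ℝ d, MemLp g 2 volume →
      ContinuousOn (fun t => ∫ x, ⟪b t x, g x⟫_ℝ) (Icc 0 T))
    {α : ℝ → ↥S → ℂ} (hα : ContinuousOn α (Icc 0 T)) :
    ContinuousOn (fun t => transportGalerkinRHS S (b t) (α t)) (Icc 0 T) := by
  intro t₀ ht₀
  have hB0 : 0 ≤ B' := (integral_nonneg fun x => norm_nonneg _).trans (hB' t₀ ht₀)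
  rw [Metric.continuousWithinAt_iff]
  intro ε hε
  -- continuity in time at the fixed coefficient `α t₀`
  have hfix := continuousOn_transportGalerkinRHS hb1 hbc (α t₀) t₀ ht₀
  obtain ⟨δ₁, hδ₁, h₁⟩ := Metric.continuousWithinAt_iff.1 hfix (ε / 2) (half_pos hε)
  -- continuity of the curve
  set K : ℝ := galerkinConst S * B' + 1 with hK
  have hK0 : 0 < K := by
    have := mul_nonneg (galerkinConst_nonneg (S := S)) hB0
    linarith
  obtain ⟨δ₂, hδ₂, h₂⟩ := Metric.continuousWithinAt_iff.1 (hα t₀ ht₀) (ε / 2 / K) (by positivity)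
  refine ⟨min δ₁ δ₂, lt_min hδ₁ hδ₂, fun t ht hdist => ?_⟩
  have hd1 : dist t t₀ < δ₁ := hdist.trans_le (min_le_left _ _)
  have hd2 : dist t t₀ < δ₂ := hdist.trans_le (min_le_right _ _)
  calc dist (transportGalerkinRHS S (b t) (α t)) (transportGalerkinRHS S (b t₀) (α t₀))
      ≤ dist (transportGalerkinRHS S (b t) (α t)) (transportGalerkinRHS S (b t) (α t₀)) +
          dist (transportGalerkinRHS S (b t) (α t₀)) (transportGalerkinRHS S (b t₀) (α t₀)) := dist_triangle _ _ _
    _ < ε / 2 + ε / 2 := by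
        refine add_lt_add_of_le_of_lt ?_ (h₁ ht hd1)
        rw [dist_eq_norm, ← transportGalerkinRHS_sub (hb1 t ht)]
        calc ‖transportGalerkinRHS S (b t) (α t - α t₀)‖
            ≤ galerkinConst S * (∫ x, ‖b t x‖) * ‖α t - α t₀‖ := norm_transportGalerkinRHS_le (hb1 t ht) _
          _ ≤ K * ‖α t - α t₀‖ := by
              refine mul_le_mul_of_nonneg_right ?_ (norm_nonneg _)
              calc galerkinConst S * ∫ x, ‖b t x‖ ≤ galerkinConst S * B' :=
                    mul_le_mul_of_nonneg_left (hB' t ht) galerkinConst_nonneg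
                _ ≤ K := by rw [hK]; linarith
          _ ≤ K * (ε / 2 / K) := by
              refine mul_le_mul_of_nonneg_left ?_ hK0.le
              have := h₂ ht hd2
              rw [dist_eq_norm] at this
              exact this.le
          _ = ε / 2 := by field_simp
    _ = ε := by ring

end AlongCurve

/-! ## Test functions: time derivatives of Fourier coefficients, truncation of gradients -/

section TestFourier

omit [DecidableEq d] in
/-- **Time derivative of the Fourier coefficients of a scalar test function**: for `ψ` with
smooth space–time lift, `d/dt 𝓕(ψ t)(k) = 𝓕(∂ₜψ t)(k)` (differentiation under the integral). [folklore] -/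
theorem hasDerivAt_mFourierCoeff_ofReal_slice {ψ : ℝ → UnitAddTorus d → ℝ} (hψ : ContDiff ℝ ∞ (stLift ψ))
    (k : d → ℤ) (t : ℝ) :
    HasDerivAt (fun s => mFourierCoeff (fun x => ((ψ s x : ℝ) : ℂ)) k)
      (mFourierCoeff (fun x => ((FunctionSpaces.Torus.timeDeriv ψ t x : ℝ) : ℂ)) k) t := by
  set Φ : ℝ → UnitAddTorus d → ℂ := fun s y => mFourier (-k) y • ((ψ s y : ℝ) : ℂ) with hΦ
  have hΦs : FunctionSpaces.Torus.IsSmoothSpaceTimeOn univ Φ := by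
    rw [FunctionSpaces.Torus.IsSmoothSpaceTimeOn, univ_prod_univ, contDiffOn_univ]
    have hχ : ContDiff ℝ ∞ (fun y : EuclideanSpace ℝ d => mFourier (-k) (proj y)) := isSmooth_mFourier (-k)
    have hcx : ContDiff ℝ ∞ (fun p : ℝ × EuclideanSpace ℝ d => ((stLift ψ p : ℝ) : ℂ)) :=
      Complex.ofRealCLM.contDiff.comp hψ
    exact (hχ.comp contDiff_snd).smul hcx
  have hder := hΦs.hasDerivWithinAt_integral convex_univ (mem_univ t)
  have hfun : (fun s => ∫ y, Φ s y) = fun s => mFourierCoeff (fun x => ((ψ s x : ℝ) : ℂ)) k := by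
    funext s
    rw [mFourierCoeff_eq_integral_volume]
  have hpt : ∀ y, FunctionSpaces.Torus.timeDerivWithin univ Φ t y = mFourier (-k) y • ((FunctionSpaces.Torus.timeDeriv ψ t y : ℝ) : ℂ) := by
    intro y
    rw [FunctionSpaces.Torus.timeDerivWithin, derivWithin_univ]
    have h1 : HasDerivAt (fun τ : ℝ => ψ τ y) (FunctionSpaces.Torus.timeDeriv ψ t y) t := hasDerivAt_slice_timeDeriv hψ t y
    have h2 := (Complex.ofRealCLM.hasFDerivAt.comp_hasDerivAt t h1).const_smul (mFourier (-k) y)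
    exact h2.deriv
  have hint : ∫ y, FunctionSpaces.Torus.timeDerivWithin univ Φ t y = mFourierCoeff (fun x => ((FunctionSpaces.Torus.timeDeriv ψ t x : ℝ) : ℂ)) k := by
    rw [mFourierCoeff_eq_integral_volume]
    exact integral_congr_ae (ae_of_all _ fun y => hpt y)
  rw [hfun, hint] at hder
  exact hder.hasDerivAt univ_mem

/-- Partial derivatives of the complexification of a smooth real scalar. [folklore] -/
theorem partialDeriv_ofReal_comp {θ : UnitAddTorus d → ℝ} (hθ : FunctionSpaces.Torus.IsSmooth θ) (j : d) :
    FunctionSpaces.Torus.partialDeriv j (fun x => ((θ x : ℝ) : ℂ)) = fun x => ((FunctionSpaces.Torus.partialDeriv j θ x : ℝ) : ℂ) := by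
  have hθC : FunctionSpaces.Torus.IsSmooth (fun x => ((θ x : ℝ) : ℂ)) := Complex.ofRealCLM.contDiff.comp hθ
  funext x
  rw [partialDeriv_eq_fderiv_apply (hθC.isContDiff (by simp)), partialDeriv_eq_fderiv_apply (hθ.isContDiff (by simp))]
  unfold FunctionSpaces.Torus.fderiv
  have hd : DifferentiableAt ℝ (liftAt θ x) 0 := ((hθ.liftAt x).differentiable (by simp)) 0
  have h : liftAt (fun x => ((θ x : ℝ) : ℂ)) x = Complex.ofRealCLM ∘ liftAt θ x := by
    funext v; rfl
  rw [h, (Complex.ofRealCLM.hasFDerivAt.comp (0 : EuclideanSpace ℝ d) hd.hasFDerivAt).fderiv]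
  rfl

/-- **Truncation commutes with partial derivatives** of smooth scalars:
`∂ⱼ (P_N θ) = P_N (∂ⱼ θ)`. [folklore] -/
theorem partialDeriv_scalarTruncate {θ : UnitAddTorus d → ℝ} (hθ : FunctionSpaces.Torus.IsSmooth θ) (N : ℕ) (j : d) :
    FunctionSpaces.Torus.partialDeriv j (scalarTruncate N θ) = scalarTruncate N (FunctionSpaces.Torus.partialDeriv j θ) := by
  funext x
  rw [scalarTruncate, scalarTruncate, partialDeriv_reTrigPoly]
  congr 1
  funext k
  have h := mFourierCoeff_partialDeriv (g := fun x => ((θ x : ℝ) : ℂ)) (Complex.ofRealCLM.contDiff.comp hθ) j k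
  rw [partialDeriv_ofReal_comp hθ] at h
  rw [h]

/-- **`L²` convergence of the gradients of the truncations of a smooth scalar**:
`∫ ‖∇θ - ∇P_N θ‖² → 0`. [folklore] -/
theorem tendsto_integral_norm_sq_gradient_sub_scalarTruncate {θ : UnitAddTorus d → ℝ} (hθ : FunctionSpaces.Torus.IsSmooth θ) :
    Tendsto (fun N => ∫ x, ‖FunctionSpaces.Torus.gradient θ x - FunctionSpaces.Torus.gradient (scalarTruncate N θ) x‖ ^ 2)
      atTop (𝓝 0) := by
  have hj : ∀ j, Tendsto (fun N => ∫ x, (FunctionSpaces.Torus.partialDeriv j θ x - scalarTruncate N (FunctionSpaces.Torus.partialDeriv j θ) x) ^ 2) atTop (𝓝 0) :=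
    fun j => tendsto_integral_sq_sub_scalarTruncate ((hθ.partialDeriv j).memLp 2)
  have hsum := tendsto_finsetSum (Finset.univ : Finset d) fun j _ => hj j
  rw [Finset.sum_const_zero] at hsum
  refine hsum.congr fun N => ?_
  have hint : ∀ j, Integrable (fun x => (FunctionSpaces.Torus.partialDeriv j θ x - scalarTruncate N (FunctionSpaces.Torus.partialDeriv j θ) x) ^ 2) volume := by
    intro j
    have hc : Continuous fun x => (FunctionSpaces.Torus.partialDeriv j θ x - scalarTruncate N (FunctionSpaces.Torus.partialDeriv j θ) x) ^ 2 :=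
      (((hθ.partialDeriv j).continuous).sub (continuous_scalarTruncate N _)).pow 2
    exact hc.integrable_of_hasCompactSupport (HasCompactSupport.of_compactSpace _)
  rw [← integral_finsetSum _ fun j _ => hint j]
  refine integral_congr_ae (ae_of_all _ fun x => ?_)
  show ∑ j, (FunctionSpaces.Torus.partialDeriv j θ x - scalarTruncate N (FunctionSpaces.Torus.partialDeriv j θ) x) ^ 2 =
    ‖FunctionSpaces.Torus.gradient θ x - FunctionSpaces.Torus.gradient (scalarTruncate N θ) x‖ ^ 2
  rw [EuclideanSpace.norm_sq_eq]
  refine Finset.sum_congr rfl fun j _ => ?_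
  rw [Real.norm_eq_abs, sq_abs, PiLp.sub_apply, gradient_eq_partialDeriv hθ, ← partialDeriv_scalarTruncate hθ,
    gradient_eq_partialDeriv (isSmooth_scalarTruncate N θ)]
where
  /-- coordinates of the gradient of a smooth scalar -/
  gradient_eq_partialDeriv {η : UnitAddTorus d → ℝ} (hη : FunctionSpaces.Torus.IsSmooth η) {x : UnitAddTorus d} {j : d} :
      FunctionSpaces.Torus.gradient η x j = FunctionSpaces.Torus.partialDeriv j η x := by
    have h := inner_gradient_eq_sum_mul_partialDeriv (hη.isContDiff (by simp)) (EuclideanSpace.single j (1 : ℝ)) x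
    rw [EuclideanSpace.inner_single_left] at h
    simpa [EuclideanSpace.single, PiLp.single_apply] using h

end TestFourier

/-! ## The tested Galerkin identity of order `N`, integrated in time -/

section PerN

variable {b : ℝ → UnitAddTorus d → EuclideanSpace ℝ d} {B : ℝ} {w₀ : UnitAddTorus d → ℝ}

/-- **Pairing the approximation with an integrable function, in coefficients**:
`∫ W_N(t) θ = ∑_{k ∈ ball} Re (α_N(t)_k 𝓕θ(-k))`. [folklore] -/
theorem integral_galerkinApprox_mul (hb : GalerkinVelocity b B) (w₀ : UnitAddTorus d → ℝ) (N : ℕ) (t : ℝ)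
    {θ : UnitAddTorus d → ℝ} (hθ : Integrable θ volume) :
    ∫ x, galerkinApprox hb w₀ N t x * θ x =
      ∑ k : ↥(freqBall (d := d) N), (galerkinCoeff hb w₀ N t k * mFourierCoeff (fun x => ((θ x : ℝ) : ℂ)) (-(k : d → ℤ))).re := by
  have h := integral_mul_reTrigPoly hθ (freqBall N) (scalarCoeffExt (freqBall N) (galerkinCoeff hb w₀ N t))
  rw [sum_scalarCoeffExt (fun k z => (z * mFourierCoeff (fun x => ((θ x : ℝ) : ℂ)) (-k)).re)] at h
  rw [← h]
  refine integral_congr_ae (ae_of_all _ fun x => ?_)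
  show galerkinApprox hb w₀ N t x * θ x = θ x * reTrigPoly (freqBall N) (scalarCoeffExt (freqBall N) (galerkinCoeff hb w₀ N t)) x
  rw [mul_comm]
  rfl

/-- The transport term of the tested identity: `Re ∑_k G(b, α)_k 𝓕(θ)(-k) = ∫ W_N ⟪b, ∇P_N θ⟫`. [folklore] -/
theorem re_sum_transportGalerkinRHS_mul_mFourierCoeff (hb : GalerkinVelocity b B) (w₀ : UnitAddTorus d → ℝ) (N : ℕ)
    {t : ℝ} (ht : 0 ≤ t) (θ : UnitAddTorus d → ℝ) :
    (∑ k : ↥(freqBall (d := d) N), transportGalerkinRHS (freqBall N) (b t) (galerkinCoeff hb w₀ N t) k *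
        mFourierCoeff (fun x => ((θ x : ℝ) : ℂ)) (-(k : d → ℤ))).re =
      ∫ x, galerkinApprox hb w₀ N t x * ⟪b t x, FunctionSpaces.Torus.gradient (scalarTruncate N θ) x⟫_ℝ := by
  have hconj : ∀ k : ↥(freqBall (d := d) N), mFourierCoeff (fun x => ((θ x : ℝ) : ℂ)) (-(k : d → ℤ)) = conj (truncCoeff N θ k) :=
    fun k => isConjSymmScalar_mFourierCoeff θ (k : d → ℤ)
  simp_rw [hconj, mul_comm _ (conj _)]
  rw [re_sum_conj_mul_transportGalerkinRHS_eq_integral neg_mem_freqBall_of_mem (isRealScalarCoeff_truncCoeff N θ) _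
    (hb.integrable t ht), galerkinPoly_truncCoeff]
  rfl

/-- **The tested Galerkin identity of order `N`, integrated in time**: for a scalar space–time test
function `ψ` vanishing for `t ≥ T₁` (`T₁ ≥ 0`),
`∫₀^{T₁} (∫ W_N ∂ₜψ + ∫ W_N ⟪b, ∇P_N ψ⟫) dt + ∫ P_N w₀ ψ(0) = 0`
(product rule on `∫ W_N(t) ψ(t) = ∑_k Re(α_k(t) 𝓕(ψ t)(-k))`, the Galerkin equations, and the
fundamental theorem of calculus; RRS 2016, (4.5) tested and integrated). [folklore] -/
theorem galerkin_tested_identity (hb : GalerkinVelocity b B) (w₀ : UnitAddTorus d → ℝ) (N : ℕ)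
    {ψ : ℝ → UnitAddTorus d → ℝ} (hψ : ContDiff ℝ ∞ (stLift ψ)) {T₁ : ℝ} (hT₁ : 0 ≤ T₁)
    (hψT₁ : ∀ t, T₁ ≤ t → ψ t = 0) :
    (∫ t in (0 : ℝ)..T₁, ((∫ x, galerkinApprox hb w₀ N t x * FunctionSpaces.Torus.timeDeriv ψ t x) +
        ∫ x, galerkinApprox hb w₀ N t x * ⟪b t x, FunctionSpaces.Torus.gradient (scalarTruncate N (ψ t)) x⟫_ℝ)) +
      ∫ x, scalarTruncate N w₀ x * ψ 0 x = 0 := by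
  set S := freqBall (d := d) N with hSdef
  set α := galerkinCoeff hb w₀ N with hαdef
  obtain ⟨hα0, -, hsol, -⟩ := galerkinCoeff_spec hb w₀ N
  -- the Fourier data of the test function
  set Ψ : ↥S → ℝ → ℂ := fun k t => mFourierCoeff (fun x => ((ψ t x : ℝ) : ℂ)) (-(k : d → ℤ)) with hΨdef
  set Ψ' : ↥S → ℝ → ℂ := fun k t => mFourierCoeff (fun x => ((FunctionSpaces.Torus.timeDeriv ψ t x : ℝ) : ℂ)) (-(k : d → ℤ))
    with hΨ'def
  have hΨ : ∀ k t, HasDerivAt (Ψ k) (Ψ' k t) t := fun k t => hasDerivAt_mFourierCoeff_ofReal_slice hψ (-(k : d → ℤ)) t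
  have hψ' : ContDiff ℝ ∞ (stLift (FunctionSpaces.Torus.timeDeriv ψ)) := by
    have h : FunctionSpaces.Torus.IsSpaceTimeTest (T₁ + 1) ψ := ⟨hψ, T₁, by linarith, hψT₁⟩
    exact h.timeDeriv.1
  have hΨ'c : ∀ k, Continuous (Ψ' k) := fun k =>
    continuous_iff_continuousAt.2 fun t => (hasDerivAt_mFourierCoeff_ofReal_slice hψ' (-(k : d → ℤ)) t).continuousAt
  have hΨc : ∀ k, Continuous (Ψ k) := fun k => continuous_iff_continuousAt.2 fun t => (hΨ k t).continuousAt
  -- the tested functional and its derivative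
  set J : ℝ → ℝ := fun t => ∑ k : ↥S, (α t k * Ψ k t).re with hJdef
  set G : ℝ → ↥S → ℂ := fun t => transportGalerkinRHS S (b t) (α t) with hGdef
  set F : ℝ → ℝ := fun t => ∑ k : ↥S, (G t k * Ψ k t + α t k * Ψ' k t).re with hFdef
  have hαk : ∀ t ∈ Icc 0 T₁, ∀ k : ↥S, HasDerivWithinAt (fun τ => α τ k) (G t k) (Icc 0 T₁) t := fun t ht k =>
    (ContinuousLinearMap.proj (R := ℝ) (φ := fun _ : ↥S => ℂ) k).hasFDerivAt.comp_hasDerivWithinAt t (hsol T₁ t ht)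
  have hderiv : ∀ t ∈ Icc 0 T₁, HasDerivWithinAt J (F t) (Icc 0 T₁) t := by
    intro t ht
    have hk : ∀ k : ↥S, HasDerivWithinAt (fun τ => (α τ k * Ψ k τ).re) ((G t k * Ψ k t + α t k * Ψ' k t).re) (Icc 0 T₁) t := by
      intro k
      have hm := (hαk t ht k).mul (hΨ k t).hasDerivWithinAt
      exact Complex.reCLM.hasFDerivAt.comp_hasDerivWithinAt t hm
    exact HasDerivWithinAt.fun_sum fun k _ => hk k
  -- continuity of the derivative
  have hαc : ContinuousOn α (Icc 0 T₁) := fun t ht => (hsol T₁ t ht).continuousWithinAt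
  have hGc : ContinuousOn G (Icc 0 T₁) :=
    continuousOn_transportGalerkinRHS_comp (fun t ht => hb.integrable t ht.1) (fun t ht => hb.norm_le t ht.1)
      (hb.weaklyContinuous T₁) hαc
  have hFc : ContinuousOn F (Icc 0 T₁) := by
    refine continuousOn_finsetSum _ fun k _ => ?_
    refine Complex.continuous_re.comp_continuousOn ((?_ : ContinuousOn _ _).add ?_)
    · exact ((continuous_apply k).comp_continuousOn hGc).mul (hΨc k).continuousOn
    · exact ((continuous_apply k).comp_continuousOn hαc).mul (hΨ'c k).continuousOn
  -- the fundamental theorem of calculus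
  have hFTC : ∫ t in (0 : ℝ)..T₁, F t = J T₁ - J 0 := by
    refine intervalIntegral.integral_eq_sub_of_hasDeriv_right_of_le hT₁ (fun t ht => (hderiv t ht).continuousWithinAt)
      (fun t ht => (hderiv t ⟨ht.1.le, ht.2.le⟩).mono_of_mem_nhdsWithin ?_) ?_
    · exact Filter.mem_of_superset (Ioo_mem_nhdsGT ht.2) fun s hs => ⟨(ht.1.trans hs.1).le, hs.2.le⟩
    · exact (hFc.mono (by rw [uIcc_of_le hT₁])).intervalIntegrable
  -- `J T₁ = 0` and `J 0 = ∫ P_N w₀ ψ(0)`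
  have hJT₁ : J T₁ = 0 := by
    simp only [hJdef, hΨdef, hψT₁ T₁ le_rfl]
    simp [mFourierCoeff_eq_integral_volume]
  have hJ0 : J 0 = ∫ x, scalarTruncate N w₀ x * ψ 0 x := by
    rw [← galerkinApprox_zero hb w₀ N, integral_galerkinApprox_mul hb w₀ N 0 (integrable_slice hψ 0)]
  -- the derivative is the sum of the two tested terms
  have hFsplit : ∀ t ∈ Icc 0 T₁, F t = (∫ x, galerkinApprox hb w₀ N t x * FunctionSpaces.Torus.timeDeriv ψ t x) +
      ∫ x, galerkinApprox hb w₀ N t x * ⟪b t x, FunctionSpaces.Torus.gradient (scalarTruncate N (ψ t)) x⟫_ℝ := by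
    intro t ht
    rw [integral_galerkinApprox_mul hb w₀ N t (integrable_slice hψ' t),
      ← re_sum_transportGalerkinRHS_mul_mFourierCoeff hb w₀ N ht.1 (ψ t), Complex.re_sum]
    show (∑ k : ↥S, (G t k * Ψ k t + α t k * Ψ' k t).re) =
      (∑ k : ↥S, (α t k * Ψ' k t).re) + ∑ k : ↥S, (G t k * Ψ k t).re
    rw [← Finset.sum_add_distrib]
    refine Finset.sum_congr rfl fun k _ => ?_
    rw [Complex.add_re, add_comm]
  rw [← intervalIntegral.integral_congr (fun t ht => hFsplit t (by rwa [uIcc_of_le hT₁] at ht)), hFTC, hJT₁, hJ0]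
  ring
where
  /-- slices of fields with smooth space–time lift are integrable -/
  integrable_slice {η : ℝ → UnitAddTorus d → ℝ} (hη : ContDiff ℝ ∞ (stLift η)) (t : ℝ) : Integrable (η t) volume := by
    have hc : Continuous (η t) := by
      have h2 : Continuous (stLift η) := hη.continuous
      exact continuous_uncurry_of_continuous_stLift h2 |>.comp (Continuous.prodMk_right t)
    exact hc.integrable_of_hasCompactSupport (HasCompactSupport.of_compactSpace _)

end PerN

/-! ## The two tested terms: coefficient formulas and continuity in time -/

section TestedTerms

variable {b : ℝ → UnitAddTorus d → EuclideanSpace ℝ d} {B : ℝ} {w₀ : UnitAddTorus d → ℝ}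

omit [DecidableEq d] in
/-- Slices of a field with smooth space–time lift are continuous. [folklore] -/
theorem continuous_slice_of_contDiff_stLift {η : ℝ → UnitAddTorus d → ℝ} (hη : ContDiff ℝ ∞ (stLift η)) (t : ℝ) :
    Continuous (η t) :=
  (continuous_uncurry_of_continuous_stLift hη.continuous).comp (Continuous.prodMk_right t)

omit [DecidableEq d] in
/-- `t ↦ 𝓕(η t)(k)` is continuous for a field with smooth space–time lift. [folklore] -/
theorem continuous_mFourierCoeff_slice {η : ℝ → UnitAddTorus d → ℝ} (hη : ContDiff ℝ ∞ (stLift η)) (k : d → ℤ) :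
    Continuous fun t => mFourierCoeff (fun x => ((η t x : ℝ) : ℂ)) k :=
  continuous_iff_continuousAt.2 fun t => (hasDerivAt_mFourierCoeff_ofReal_slice hη k t).continuousAt

/-- **Continuity in time of the time-derivative tested term** `t ↦ ∫ W_N(t) ∂ₜψ(t)` on `[0,T]`. [folklore] -/
theorem continuousOn_integral_galerkinApprox_mul_timeDeriv (hb : GalerkinVelocity b B) (w₀ : UnitAddTorus d → ℝ) (N : ℕ)
    {ψ : ℝ → UnitAddTorus d → ℝ} (hψ' : ContDiff ℝ ∞ (stLift (FunctionSpaces.Torus.timeDeriv ψ)))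
    (T : ℝ) :
    ContinuousOn (fun t => ∫ x, galerkinApprox hb w₀ N t x * FunctionSpaces.Torus.timeDeriv ψ t x) (Icc 0 T) := by
  obtain ⟨-, -, hsol, -⟩ := galerkinCoeff_spec hb w₀ N
  have hαc : ContinuousOn (galerkinCoeff hb w₀ N) (Icc 0 T) := fun t ht => (hsol T t ht).continuousWithinAt
  have h : ContinuousOn (fun t => ∑ k : ↥(freqBall (d := d) N), (galerkinCoeff hb w₀ N t k *
      mFourierCoeff (fun x => ((FunctionSpaces.Torus.timeDeriv ψ t x : ℝ) : ℂ)) (-(k : d → ℤ))).re) (Icc 0 T) := by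
    refine continuousOn_finsetSum _ fun k _ => Complex.continuous_re.comp_continuousOn ?_
    exact ((continuous_apply k).comp_continuousOn hαc).mul (continuous_mFourierCoeff_slice hψ' _).continuousOn
  refine h.congr fun t _ => ?_
  have hψc := continuous_slice_of_contDiff_stLift hψ' t
  exact integral_galerkinApprox_mul hb w₀ N t (hψc.integrable_of_hasCompactSupport (HasCompactSupport.of_compactSpace _))

/-- **Continuity in time of the transport tested term** `t ↦ ∫ W_N(t) ⟪b(t), ∇P_N ψ(t)⟫` on `[0,T]`. [folklore] -/
theorem continuousOn_integral_galerkinApprox_mul_inner (hb : GalerkinVelocity b B) (w₀ : UnitAddTorus d → ℝ) (N : ℕ)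
    {ψ : ℝ → UnitAddTorus d → ℝ} (hψ : ContDiff ℝ ∞ (stLift ψ)) {T : ℝ} :
    ContinuousOn (fun t => ∫ x, galerkinApprox hb w₀ N t x *
      ⟪b t x, FunctionSpaces.Torus.gradient (scalarTruncate N (ψ t)) x⟫_ℝ) (Icc 0 T) := by
  obtain ⟨-, -, hsol, -⟩ := galerkinCoeff_spec hb w₀ N
  have hαc : ContinuousOn (galerkinCoeff hb w₀ N) (Icc 0 T) := fun t ht => (hsol T t ht).continuousWithinAt
  have hGc : ContinuousOn (fun t => transportGalerkinRHS (freqBall N) (b t) (galerkinCoeff hb w₀ N t)) (Icc 0 T) :=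
    continuousOn_transportGalerkinRHS_comp (fun t ht => hb.integrable t ht.1) (fun t ht => hb.norm_le t ht.1)
      (hb.weaklyContinuous T) hαc
  have h : ContinuousOn (fun t => (∑ k : ↥(freqBall (d := d) N), transportGalerkinRHS (freqBall N) (b t) (galerkinCoeff hb w₀ N t) k *
      mFourierCoeff (fun x => ((ψ t x : ℝ) : ℂ)) (-(k : d → ℤ))).re) (Icc 0 T) := by
    refine Complex.continuous_re.comp_continuousOn (continuousOn_finsetSum _ fun k _ => ?_)
    exact ((continuous_apply k).comp_continuousOn hGc).mul (continuous_mFourierCoeff_slice hψ _).continuousOn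
  refine h.congr fun t ht => ?_
  exact (re_sum_transportGalerkinRHS_mul_mFourierCoeff hb w₀ N ht.1 (ψ t)).symm

end TestedTerms

/-! ## Tools for the passage to the limit -/

section LimitTools

omit [DecidableEq d] in
/-- **`L²` convergence gives convergence of pairings**: if `∫ (fₙ - f)² → 0` then `∫ fₙ g → ∫ f g`
for every `g ∈ L²` (weighted Cauchy–Schwarz). [folklore] -/
theorem tendsto_integral_mul_of_tendsto_integral_sq_sub {f : ℕ → UnitAddTorus d → ℝ} {f₀ : UnitAddTorus d → ℝ}
    (hf : ∀ n, MemLp (f n) 2 volume) (hf₀ : MemLp f₀ 2 volume)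
    (hconv : Tendsto (fun n => ∫ x, (f n x - f₀ x) ^ 2) atTop (𝓝 0)) {g : UnitAddTorus d → ℝ} (hg : MemLp g 2 volume) :
    Tendsto (fun n => ∫ x, f n x * g x) atTop (𝓝 (∫ x, f₀ x * g x)) := by
  rw [Metric.tendsto_atTop]
  intro ε hε
  set Gg : ℝ := ∫ x, g x ^ 2 with hGg
  have hG0 : 0 ≤ Gg := integral_nonneg fun x => sq_nonneg _
  set δ : ℝ := (Gg + 1) / ε with hδ
  have hδ0 : 0 < δ := by positivity
  have hev : ∀ᶠ n in atTop, ∫ x, (f n x - f₀ x) ^ 2 < ε / δ := (tendsto_order.1 hconv).2 _ (by positivity)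
  obtain ⟨N, hN⟩ := eventually_atTop.1 hev
  refine ⟨N, fun n hn => ?_⟩
  have hsub : MemLp (fun x => f n x - f₀ x) 2 volume := (hf n).sub hf₀
  have hsplit : (∫ x, f n x * g x) - ∫ x, f₀ x * g x = ∫ x, (f n x - f₀ x) * g x := by
    have i1 : Integrable (fun x => f n x * g x) volume := (hf n).integrable_mul hg
    have i2 : Integrable (fun x => f₀ x * g x) volume := hf₀.integrable_mul hg
    rw [← integral_sub i1 i2]
    exact integral_congr_ae (ae_of_all _ fun x => by ring)
  rw [Real.dist_eq, hsplit]
  have hb := abs_integral_mul_le_weighted hsub hg hδ0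
  have h1 : δ * ∫ x, (f n x - f₀ x) ^ 2 < δ * (ε / δ) := mul_lt_mul_of_pos_left (hN n hn) hδ0
  have h2 : δ * (ε / δ) = ε := by field_simp
  have h3 : δ⁻¹ * Gg < ε := by
    rw [hδ, inv_div, div_mul_eq_mul_div, div_lt_iff₀ (by positivity)]
    nlinarith
  linarith

/-- **Bessel for the gradient of a truncation** of a smooth scalar: `∫ ‖∇P_N θ‖² ≤ ∫ ‖∇θ‖²`. [folklore] -/
theorem integral_norm_sq_gradient_scalarTruncate_le {θ : UnitAddTorus d → ℝ} (hθ : FunctionSpaces.Torus.IsSmooth θ) (N : ℕ) :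
    ∫ x, ‖FunctionSpaces.Torus.gradient (scalarTruncate N θ) x‖ ^ 2 ≤ ∫ x, ‖FunctionSpaces.Torus.gradient θ x‖ ^ 2 := by
  have hcoordP : ∀ x, ‖FunctionSpaces.Torus.gradient (scalarTruncate N θ) x‖ ^ 2 =
      ∑ j, scalarTruncate N (FunctionSpaces.Torus.partialDeriv j θ) x ^ 2 := by
    intro x
    rw [EuclideanSpace.norm_sq_eq]
    refine Finset.sum_congr rfl fun j _ => ?_
    rw [Real.norm_eq_abs, sq_abs, tendsto_integral_norm_sq_gradient_sub_scalarTruncate.gradient_eq_partialDeriv (isSmooth_scalarTruncate N θ),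
      partialDeriv_scalarTruncate hθ]
  have hcoord : ∀ x, ‖FunctionSpaces.Torus.gradient θ x‖ ^ 2 = ∑ j, FunctionSpaces.Torus.partialDeriv j θ x ^ 2 := by
    intro x
    rw [EuclideanSpace.norm_sq_eq]
    refine Finset.sum_congr rfl fun j _ => ?_
    rw [Real.norm_eq_abs, sq_abs, tendsto_integral_norm_sq_gradient_sub_scalarTruncate.gradient_eq_partialDeriv hθ]
  simp_rw [hcoordP, hcoord]
  have hiP : ∀ j, Integrable (fun x => scalarTruncate N (FunctionSpaces.Torus.partialDeriv j θ) x ^ 2) volume := fun j =>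
    ((continuous_scalarTruncate N _).pow 2).integrable_of_hasCompactSupport (HasCompactSupport.of_compactSpace _)
  have hi : ∀ j, Integrable (fun x => FunctionSpaces.Torus.partialDeriv j θ x ^ 2) volume := fun j =>
    (((hθ.partialDeriv j).continuous).pow 2).integrable_of_hasCompactSupport (HasCompactSupport.of_compactSpace _)
  rw [integral_finsetSum _ fun j _ => hiP j, integral_finsetSum _ fun j _ => hi j]
  refine Finset.sum_le_sum fun j _ => ?_
  rw [integral_sq_scalarTruncate]
  exact sum_sq_norm_mFourierCoeff_le_integral_sq ((hθ.partialDeriv j).memLp 2) N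

omit [DecidableEq d] in
/-- Pairings `⟪b, G⟫` with an `L²` field and a bounded continuous `G` are in `L²`. [folklore] -/
theorem memLp_inner_of_continuous_bound {v : UnitAddTorus d → EuclideanSpace ℝ d} (hv : MemLp v 2 volume)
    {G : UnitAddTorus d → EuclideanSpace ℝ d} (hG : Continuous G) {C : ℝ} (hC : ∀ x, ‖G x‖ ≤ C) :
    MemLp (fun x => ⟪v x, G x⟫_ℝ) 2 volume := by
  have h1 : MemLp (fun x => C * ‖v x‖) 2 volume := hv.norm.const_mul C
  refine h1.of_le (hv.1.inner hG.aestronglyMeasurable) (ae_of_all _ fun x => ?_)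
  rw [Real.norm_eq_abs, Real.norm_eq_abs]
  calc |⟪v x, G x⟫_ℝ| ≤ ‖v x‖ * ‖G x‖ := abs_real_inner_le_norm _ _
    _ ≤ ‖v x‖ * C := mul_le_mul_of_nonneg_left (hC x) (norm_nonneg _)
    _ = |C * ‖v x‖| := by
        rw [abs_of_nonneg (mul_nonneg ((norm_nonneg _).trans (hC x)) (norm_nonneg _))]
        ring

omit [DecidableEq d] in
/-- **The basic estimate for the transport pairing**: `|∫ W ⟪v, G⟫| ≤ Bb (δ ∫ W² + δ⁻¹ ∫ ‖G‖²)/2`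
for `‖v‖ ≤ Bb` a.e. [folklore] -/
theorem abs_integral_mul_inner_le {W : UnitAddTorus d → ℝ} (hW : MemLp W 2 volume)
    {v : UnitAddTorus d → EuclideanSpace ℝ d} (hvm : AEStronglyMeasurable v volume) {Bb : ℝ} (hBb : 0 ≤ Bb)
    (hv : ∀ᵐ x, ‖v x‖ ≤ Bb) {G : UnitAddTorus d → EuclideanSpace ℝ d} (hG : MemLp G 2 volume) {δ : ℝ} (hδ : 0 < δ) :
    |∫ x, W x * ⟪v x, G x⟫_ℝ| ≤ Bb * ((δ * (∫ x, W x ^ 2) + δ⁻¹ * ∫ x, ‖G x‖ ^ 2) / 2) := by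
  have hW2 : Integrable (fun x => W x ^ 2) volume := by simpa using hW.integrable_norm_pow two_ne_zero
  have hG2 : Integrable (fun x => ‖G x‖ ^ 2) volume := hG.integrable_norm_pow two_ne_zero
  have hprod : Integrable (fun x => |W x| * ‖G x‖) volume := by
    have h := hW.norm.integrable_mul hG.norm
    exact h.congr (ae_of_all _ fun x => by simp [Real.norm_eq_abs])
  calc |∫ x, W x * ⟪v x, G x⟫_ℝ| ≤ ∫ x, |W x * ⟪v x, G x⟫_ℝ| := abs_integral_le_integral_abs
    _ ≤ ∫ x, Bb * (|W x| * ‖G x‖) := by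
        refine integral_mono_ae ?_ (hprod.const_mul Bb) ?_
        · exact (hW.integrable_mul (memLp_two_inner hvm hBb hv hG)).abs
        · filter_upwards [hv] with x hx
          rw [abs_mul]
          calc |W x| * |⟪v x, G x⟫_ℝ| ≤ |W x| * (‖v x‖ * ‖G x‖) :=
                mul_le_mul_of_nonneg_left (abs_real_inner_le_norm _ _) (abs_nonneg _)
            _ ≤ |W x| * (Bb * ‖G x‖) := mul_le_mul_of_nonneg_left (mul_le_mul_of_nonneg_right hx (norm_nonneg _)) (abs_nonneg _)
            _ = Bb * (|W x| * ‖G x‖) := by ring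
    _ = Bb * ∫ x, |W x| * ‖G x‖ := integral_const_mul _ _
    _ ≤ Bb * ((δ * (∫ x, W x ^ 2) + δ⁻¹ * ∫ x, ‖G x‖ ^ 2) / 2) := by
        refine mul_le_mul_of_nonneg_left ?_ hBb
        calc ∫ x, |W x| * ‖G x‖ ≤ ∫ x, (δ * W x ^ 2 + δ⁻¹ * ‖G x‖ ^ 2) / 2 := by
              refine integral_mono hprod (((hW2.const_mul δ).add (hG2.const_mul δ⁻¹)).div_const 2) fun x => ?_
              have key : 2 * δ * (|W x| * ‖G x‖) ≤ δ ^ 2 * W x ^ 2 + ‖G x‖ ^ 2 := by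
                nlinarith [sq_nonneg (δ * |W x| - ‖G x‖), sq_abs (W x), norm_nonneg (G x)]
              rw [le_div_iff₀ (by norm_num : (0 : ℝ) < 2)]
              have h2 : δ ^ 2 * W x ^ 2 + ‖G x‖ ^ 2 = δ * (δ * W x ^ 2 + δ⁻¹ * ‖G x‖ ^ 2) := by field_simp
              nlinarith [mul_comm (|W x| * ‖G x‖) 2]
          _ = (δ * (∫ x, W x ^ 2) + δ⁻¹ * ∫ x, ‖G x‖ ^ 2) / 2 := by
              rw [integral_div, integral_add (hW2.const_mul δ) (hG2.const_mul δ⁻¹), integral_const_mul, integral_const_mul]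
where
  /-- `⟪v, G⟫ ∈ L²` for bounded `v` and `G ∈ L²` -/
  memLp_two_inner {v : UnitAddTorus d → EuclideanSpace ℝ d} (hvm : AEStronglyMeasurable v volume) {Bb : ℝ} (hBb : 0 ≤ Bb)
      (hv : ∀ᵐ x, ‖v x‖ ≤ Bb) {G : UnitAddTorus d → EuclideanSpace ℝ d} (hG : MemLp G 2 volume) :
      MemLp (fun x => ⟪v x, G x⟫_ℝ) 2 volume := by
    have h1 : MemLp (fun x => Bb * ‖G x‖) 2 volume := hG.norm.const_mul Bb
    refine h1.of_le (hvm.inner hG.1) ?_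
    filter_upwards [hv] with x hx
    rw [Real.norm_eq_abs, Real.norm_eq_abs]
    calc |⟪v x, G x⟫_ℝ| ≤ ‖v x‖ * ‖G x‖ := abs_real_inner_le_norm _ _
      _ ≤ Bb * ‖G x‖ := mul_le_mul_of_nonneg_right hx (norm_nonneg _)
      _ = |Bb * ‖G x‖| := by rw [abs_of_nonneg (mul_nonneg hBb (norm_nonneg _))]

end LimitTools

/-! ## Passage to the limit in the weak formulation -/

section WeakForm

variable {b : ℝ → UnitAddTorus d → EuclideanSpace ℝ d} {B : ℝ} {w₀ : UnitAddTorus d → ℝ}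
variable {hb : GalerkinVelocity b B} {hw₀ : MemLp w₀ 2 volume}
variable {φ : ℕ → ℕ} {c : ℝ → (d → ℤ) → ℂ} {w : ℝ → UnitAddTorus d → ℝ}

/-- **The weak transport identity of a Galerkin limit.** Let `w` be a Galerkin limit for the
velocity `b` (`GalerkinVelocity b B`, additionally essentially bounded, `‖b(t)‖ ≤ Bb` a.e., for
a.e. `t ∈ (0,T)`) and the datum `w₀ ∈ L²`. Then for every `T > 0` and every scalar space–time test function
`ψ` on `[0,T)`,
`∫₀ᵀ ∫ w (∂ₜψ + ⟪b, ∇ψ⟫ + 0·Δψ) + ∫ w₀ ψ(0) = 0`: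
the tested Galerkin identities (`galerkin_tested_identity`) pass to the limit along the
subsequence by weak convergence of the slices (`IsGalerkinLimit.tendsto_integral_mul`), the `L²`
convergence of the truncated gradients and of `P_N w₀`, and dominated convergence in time
(Robinson–Rodrigo–Sadowski 2016, proof of Thm. 4.4, Step 4, for the linear terms). [folklore] -/
theorem IsGalerkinLimit.weak_eq (h : IsGalerkinLimit hb hw₀ φ c w) {T : ℝ} (hT : 0 < T) {Bb : ℝ} (hBb : 0 ≤ Bb)
    (hbB : ∀ᵐ t, t ∈ Ioo 0 T → ∀ᵐ x, ‖b t x‖ ≤ Bb)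
    {ψ : ℝ → UnitAddTorus d → ℝ} (hψ : FunctionSpaces.Torus.IsSpaceTimeTest T ψ) :
    (∫ t in Ioo 0 T, ∫ x, w t x * (FunctionSpaces.Torus.timeDeriv ψ t x +
        ⟪b t x, FunctionSpaces.Torus.gradient (ψ t) x⟫_ℝ + 0 * FunctionSpaces.Torus.laplacian (ψ t) x)) +
      ∫ x, w₀ x * ψ 0 x = 0 := by
  obtain ⟨hψs, T', hT'T, hψT'⟩ := hψ
  have hψst : FunctionSpaces.Torus.IsSpaceTimeTest T ψ := ⟨hψs, T', hT'T, hψT'⟩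
  -- the effective horizon
  set T₁ : ℝ := max T' 0 with hT₁def
  have hT₁0 : 0 ≤ T₁ := le_max_right _ _
  have hT₁T : T₁ < T := max_lt hT'T hT
  have hψT₁ : ∀ t, T₁ ≤ t → ψ t = 0 := fun t ht => hψT' t ((le_max_left _ _).trans ht)
  have hψ' : ContDiff ℝ ∞ (stLift (FunctionSpaces.Torus.timeDeriv ψ)) := hψst.timeDeriv.1
  -- notation for the tested terms
  set W : ℕ → ℝ → UnitAddTorus d → ℝ := fun n => galerkinApprox hb w₀ (φ n) with hWdef
  set Dn : ℕ → ℝ → ℝ := fun n t => ∫ x, W n t x * FunctionSpaces.Torus.timeDeriv ψ t x with hDndef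
  set An : ℕ → ℝ → ℝ := fun n t => ∫ x, W n t x *
      ⟪b t x, FunctionSpaces.Torus.gradient (scalarTruncate (φ n) (ψ t)) x⟫_ℝ with hAndef
  set Dl : ℝ → ℝ := fun t => ∫ x, w t x * FunctionSpaces.Torus.timeDeriv ψ t x with hDldef
  set Al : ℝ → ℝ := fun t => ∫ x, w t x * ⟪b t x, FunctionSpaces.Torus.gradient (ψ t) x⟫_ℝ with hAldef
  -- the identities of order `φ n`
  have hID : ∀ n, (∫ t in Ioc 0 T₁, (Dn n t + An n t)) + ∫ x, scalarTruncate (φ n) w₀ x * ψ 0 x = 0 := by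
    intro n
    have hid := galerkin_tested_identity hb w₀ (φ n) hψs hT₁0 hψT₁
    rwa [intervalIntegral.integral_of_le hT₁0] at hid
  -- uniform bounds for the test data on `[0, T₁]`
  obtain ⟨C₁, hC₁⟩ := exists_bound_of_continuous_uncurry (FunctionSpaces.Torus.IsSpaceTimeTest.continuous_uncurry hψst.timeDeriv) 0 T₁
  obtain ⟨C₂, hC₂⟩ := exists_bound_of_continuous_uncurry hψst.continuous_uncurry_gradient 0 T₁
  set E : ℝ := ∫ x, w₀ x ^ 2 with hEdef
  have hE0 : 0 ≤ E := integral_nonneg fun x => sq_nonneg _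
  have hWb : ∀ n, ∀ t, 0 ≤ t → ∫ x, W n t x ^ 2 ≤ E := fun n t ht => integral_sq_galerkinApprox_le hb hw₀ (φ n) ht
  have hWm : ∀ n t, MemLp (W n t) 2 volume := fun n t => memLp_reTrigPoly _ _ 2
  -- slice facts for the test data
  have hψt : ∀ t, FunctionSpaces.Torus.IsSmooth (ψ t) := fun t => hψst.isSmooth_slice t
  have hDt : ∀ t, MemLp (FunctionSpaces.Torus.timeDeriv ψ t) 2 volume := fun t =>
    (continuous_slice_of_contDiff_stLift hψ' t).memLp_of_hasCompactSupport (HasCompactSupport.of_compactSpace _)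
  have hGm : ∀ n t, MemLp (FunctionSpaces.Torus.gradient (scalarTruncate n (ψ t))) 2 volume := fun n t =>
    (isSmooth_scalarTruncate n (ψ t)).gradient.memLp 2
  have hgt : ∀ t, 0 ≤ t → MemLp (fun x => ⟪b t x, FunctionSpaces.Torus.gradient (ψ t) x⟫_ℝ) 2 volume := by
    intro t ht
    obtain ⟨Ct, hCt⟩ := exists_bound_of_continuous_uncurry hψst.continuous_uncurry_gradient t t
    exact memLp_inner_of_continuous_bound (hb.memLp t ht) (hψt t).gradient.continuous fun x => hCt t ⟨le_rfl, le_rfl⟩ x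
  -- Step 1: pointwise limits of the tested terms for `t ∈ [0, T₁]`
  have hDlim : ∀ t, 0 ≤ t → Tendsto (fun n => Dn n t) atTop (𝓝 (Dl t)) := fun t ht =>
    h.tendsto_integral_mul ht (hDt t)
  have hAlim : ∀ᵐ t, t ∈ Ioc 0 T₁ → Tendsto (fun n => An n t) atTop (𝓝 (Al t)) := by
    filter_upwards [hbB] with t hbt htI
    have hbt : ∀ᵐ x, ‖b t x‖ ≤ Bb := hbt ⟨htI.1, htI.2.trans_lt hT₁T⟩
    have ht : t ∈ Icc 0 T₁ := Ioc_subset_Icc_self htI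
    -- split `An n t = ∫ W ⟪b, ∇ψ⟫ + ∫ W ⟪b, ∇P_n ψ - ∇ψ⟫`
    have h1 : Tendsto (fun n => ∫ x, W n t x * ⟪b t x, FunctionSpaces.Torus.gradient (ψ t) x⟫_ℝ) atTop (𝓝 (Al t)) :=
      h.tendsto_integral_mul ht.1 (hgt t ht.1)
    have h2 : Tendsto (fun n => ∫ x, W n t x *
        ⟪b t x, FunctionSpaces.Torus.gradient (scalarTruncate (φ n) (ψ t)) x - FunctionSpaces.Torus.gradient (ψ t) x⟫_ℝ)
        atTop (𝓝 0) := by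
      rw [Metric.tendsto_atTop]
      intro ε hε
      set δ : ℝ := ε / (Bb * E + 1) with hδ
      have hδ0 : 0 < δ := by positivity
      have hgrad := (tendsto_integral_norm_sq_gradient_sub_scalarTruncate (hψt t)).comp h.strictMono.tendsto_atTop
      have hev : ∀ᶠ n in atTop, ∫ x, ‖FunctionSpaces.Torus.gradient (ψ t) x -
          FunctionSpaces.Torus.gradient (scalarTruncate (φ n) (ψ t)) x‖ ^ 2 < δ * ε / (Bb + 1) :=
        (tendsto_order.1 hgrad).2 _ (by positivity)
      obtain ⟨N, hN⟩ := eventually_atTop.1 hev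
      refine ⟨N, fun n hn => ?_⟩
      rw [Real.dist_0_eq_abs]
      have hGd : MemLp (fun x => FunctionSpaces.Torus.gradient (scalarTruncate (φ n) (ψ t)) x -
          FunctionSpaces.Torus.gradient (ψ t) x) 2 volume := (hGm (φ n) t).sub ((hψt t).gradient.memLp 2)
      have hb1 := abs_integral_mul_inner_le (hWm n t) (hb.memLp t ht.1).1 hBb hbt hGd hδ0
      have hnorm : ∫ x, ‖FunctionSpaces.Torus.gradient (scalarTruncate (φ n) (ψ t)) x - FunctionSpaces.Torus.gradient (ψ t) x‖ ^ 2 =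
          ∫ x, ‖FunctionSpaces.Torus.gradient (ψ t) x - FunctionSpaces.Torus.gradient (scalarTruncate (φ n) (ψ t)) x‖ ^ 2 :=
        integral_congr_ae (ae_of_all _ fun x => congrArg (fun r : ℝ => r ^ 2) (norm_sub_rev _ _))
      rw [hnorm] at hb1
      have hq := hN n hn
      have h3 : Bb * (δ * E) < ε := by
        rw [hδ]
        have : Bb * (ε / (Bb * E + 1) * E) = ε * (Bb * E / (Bb * E + 1)) := by ring
        rw [this]
        have h4 : Bb * E / (Bb * E + 1) < 1 := by rw [div_lt_one (by positivity)]; linarith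
        nlinarith
      have h5 : Bb * (δ⁻¹ * (δ * ε / (Bb + 1))) ≤ ε := by
        have h6 : δ⁻¹ * (δ * ε / (Bb + 1)) = ε / (Bb + 1) := by field_simp
        rw [h6, mul_div_assoc', div_le_iff₀ (by positivity)]
        nlinarith
      calc |∫ x, W n t x * ⟪b t x, FunctionSpaces.Torus.gradient (scalarTruncate (φ n) (ψ t)) x - FunctionSpaces.Torus.gradient (ψ t) x⟫_ℝ|
          ≤ Bb * ((δ * (∫ x, W n t x ^ 2) + δ⁻¹ * ∫ x, ‖FunctionSpaces.Torus.gradient (ψ t) x -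
              FunctionSpaces.Torus.gradient (scalarTruncate (φ n) (ψ t)) x‖ ^ 2) / 2) := hb1
        _ ≤ Bb * ((δ * E + δ⁻¹ * (δ * ε / (Bb + 1))) / 2) := by
            refine mul_le_mul_of_nonneg_left ?_ hBb
            have i1 := mul_le_mul_of_nonneg_left (hWb n t ht.1) hδ0.le
            have i2 := mul_le_mul_of_nonneg_left hq.le (inv_pos.2 hδ0).le
            linarith
        _ < ε := by nlinarith
    have hsum := h1.add h2
    rw [add_zero] at hsum
    refine hsum.congr fun n => ?_
    have i1 : Integrable (fun x => W n t x * ⟪b t x, FunctionSpaces.Torus.gradient (ψ t) x⟫_ℝ) volume :=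
      (hWm n t).integrable_mul (hgt t ht.1)
    have i2 : Integrable (fun x => W n t x *
        ⟪b t x, FunctionSpaces.Torus.gradient (scalarTruncate (φ n) (ψ t)) x - FunctionSpaces.Torus.gradient (ψ t) x⟫_ℝ) volume :=
      (hWm n t).integrable_mul (abs_integral_mul_inner_le.memLp_two_inner (hb.memLp t ht.1).1 hBb hbt
        ((hGm (φ n) t).sub ((hψt t).gradient.memLp 2)))
    rw [← integral_add i1 i2]
    refine integral_congr_ae (ae_of_all _ fun x => ?_)
    simp only [inner_sub_right]
    ring
  -- Step 2: uniform bounds for dominated convergence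
  set Kb : ℝ := (E + C₁ ^ 2) / 2 + Bb * ((E + C₂ ^ 2) / 2) with hKb
  have hbound : ∀ᵐ t, t ∈ Ioc 0 T₁ → ∀ n, ‖Dn n t + An n t‖ ≤ Kb := by
    filter_upwards [hbB] with t hbt htI n
    have hbt : ∀ᵐ x, ‖b t x‖ ≤ Bb := hbt ⟨htI.1, htI.2.trans_lt hT₁T⟩
    have ht : t ∈ Icc 0 T₁ := Ioc_subset_Icc_self htI
    have hD : |Dn n t| ≤ (E + C₁ ^ 2) / 2 := by
      have hb1 := abs_integral_mul_le_weighted (hWm n t) (hDt t) one_pos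
      simp only [one_mul, inv_one] at hb1
      refine hb1.trans ?_
      gcongr
      · exact hWb n t ht.1
      · calc ∫ x, FunctionSpaces.Torus.timeDeriv ψ t x ^ 2 ≤ ∫ x, C₁ ^ 2 := by
              refine integral_mono (by simpa using (hDt t).integrable_norm_pow two_ne_zero) (integrable_const _) fun x => ?_
              have h1 := hC₁ t ht x
              rw [Real.norm_eq_abs] at h1
              nlinarith [abs_nonneg (FunctionSpaces.Torus.timeDeriv ψ t x), sq_abs (FunctionSpaces.Torus.timeDeriv ψ t x)]
          _ = C₁ ^ 2 := by simp
    have hA : |An n t| ≤ Bb * ((E + C₂ ^ 2) / 2) := by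
      have hb1 := abs_integral_mul_inner_le (hWm n t) (hb.memLp t ht.1).1 hBb hbt (hGm (φ n) t) one_pos
      simp only [one_mul, inv_one] at hb1
      refine hb1.trans (mul_le_mul_of_nonneg_left ?_ hBb)
      gcongr
      · exact hWb n t ht.1
      · calc ∫ x, ‖FunctionSpaces.Torus.gradient (scalarTruncate (φ n) (ψ t)) x‖ ^ 2
            ≤ ∫ x, ‖FunctionSpaces.Torus.gradient (ψ t) x‖ ^ 2 := integral_norm_sq_gradient_scalarTruncate_le (hψt t) _
          _ ≤ ∫ x, C₂ ^ 2 := by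
              refine integral_mono (((hψt t).gradient.memLp 2).integrable_norm_pow two_ne_zero) (integrable_const _) fun x => ?_
              have h1 := hC₂ t ht x
              nlinarith [norm_nonneg (FunctionSpaces.Torus.gradient (ψ t) x)]
          _ = C₂ ^ 2 := by simp
    rw [Real.norm_eq_abs]
    exact (abs_add_le _ _).trans (add_le_add hD hA)
  -- Step 3: dominated convergence on `(0, T₁]`
  have hDCT : Tendsto (fun n => ∫ t in Ioc 0 T₁, (Dn n t + An n t)) atTop (𝓝 (∫ t in Ioc 0 T₁, (Dl t + Al t))) := by
    refine tendsto_integral_of_dominated_convergence (fun _ => Kb) (fun n => ?_) (integrable_const Kb) (fun n => ?_) ?_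
    · have hc : ContinuousOn (fun t => Dn n t + An n t) (Icc 0 T₁) :=
        (continuousOn_integral_galerkinApprox_mul_timeDeriv hb w₀ (φ n) hψ' T₁).add
          (continuousOn_integral_galerkinApprox_mul_inner hb w₀ (φ n) hψs)
      exact (hc.mono Ioc_subset_Icc_self).aestronglyMeasurable measurableSet_Ioc
    · rw [ae_restrict_iff' measurableSet_Ioc]
      filter_upwards [hbound] with t ht hmem
      exact ht hmem n
    · rw [ae_restrict_iff' measurableSet_Ioc]
      filter_upwards [hAlim] with t ht hmem
      exact (hDlim t hmem.1.le).add (ht hmem)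
  -- Step 4: the datum term
  have hdat : Tendsto (fun n => ∫ x, scalarTruncate (φ n) w₀ x * ψ 0 x) atTop (𝓝 (∫ x, w₀ x * ψ 0 x)) := by
    have hconv := (tendsto_integral_sq_sub_scalarTruncate hw₀).comp h.strictMono.tendsto_atTop
    refine tendsto_integral_mul_of_tendsto_integral_sq_sub (fun n => memLp_scalarTruncate _ _ 2) hw₀ ?_ ((hψt 0).memLp 2)
    refine hconv.congr fun n => integral_congr_ae (ae_of_all _ fun x => ?_)
    show (w₀ x - scalarTruncate (φ n) w₀ x) ^ 2 = (scalarTruncate (φ n) w₀ x - w₀ x) ^ 2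
    ring
  -- Step 5: the limit identity on `(0, T₁]`
  have hlim : (∫ t in Ioc 0 T₁, (Dl t + Al t)) + ∫ x, w₀ x * ψ 0 x = 0 := by
    have h1 := hDCT.add hdat
    simp_rw [hID] at h1
    exact (tendsto_nhds_unique tendsto_const_nhds h1).symm
  -- Step 6: from `(0, T₁]` to `(0, T)` and the merged integrand
  have hmerge : ∀ t, 0 ≤ t → Dl t + Al t = ∫ x, w t x * (FunctionSpaces.Torus.timeDeriv ψ t x +
      ⟪b t x, FunctionSpaces.Torus.gradient (ψ t) x⟫_ℝ + 0 * FunctionSpaces.Torus.laplacian (ψ t) x) := by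
    intro t ht
    have i1 : Integrable (fun x => w t x * FunctionSpaces.Torus.timeDeriv ψ t x) volume := (h.memLp t ht).integrable_mul (hDt t)
    have i2 : Integrable (fun x => w t x * ⟪b t x, FunctionSpaces.Torus.gradient (ψ t) x⟫_ℝ) volume :=
      (h.memLp t ht).integrable_mul (hgt t ht)
    rw [show Dl t + Al t = (∫ x, w t x * FunctionSpaces.Torus.timeDeriv ψ t x) +
        ∫ x, w t x * ⟪b t x, FunctionSpaces.Torus.gradient (ψ t) x⟫_ℝ from rfl, ← integral_add i1 i2]
    refine integral_congr_ae (ae_of_all _ fun x => ?_)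
    ring
  have hzero : ∀ t ∈ Ioo 0 T \ Ioc 0 T₁, (∫ x, w t x * (FunctionSpaces.Torus.timeDeriv ψ t x +
      ⟪b t x, FunctionSpaces.Torus.gradient (ψ t) x⟫_ℝ + 0 * FunctionSpaces.Torus.laplacian (ψ t) x)) = 0 := by
    intro t ht
    have htT₁ : T₁ < t := by
      by_contra hle
      exact ht.2 ⟨ht.1.1, not_lt.1 hle⟩
    have hψ0 : ψ t = 0 := hψT₁ t htT₁.le
    have hder : FunctionSpaces.Torus.timeDeriv ψ t = 0 := by
      funext x
      have hev : (fun τ => ψ τ x) =ᶠ[𝓝 t] fun _ => (0 : ℝ) := by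
        filter_upwards [Ioi_mem_nhds htT₁] with τ hτ
        rw [hψT₁ τ (le_of_lt hτ), Pi.zero_apply]
      show deriv (fun τ => ψ τ x) t = 0
      rw [hev.deriv_eq, deriv_const]
    have hgrad : ∀ x, FunctionSpaces.Torus.gradient (ψ t) x = 0 := by
      intro x
      rw [hψ0]
      show _root_.gradient (liftAt (0 : UnitAddTorus d → ℝ) x) 0 = 0
      have : liftAt (0 : UnitAddTorus d → ℝ) x = fun _ => 0 := rfl
      rw [this, gradient_fun_const]
    simp [hder, hgrad]
  rw [setIntegral_eq_of_subset_of_forall_sdiff_eq_zero measurableSet_Ioo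
    (fun t ht => ⟨ht.1, ht.2.trans_lt hT₁T⟩) hzero]
  rw [← setIntegral_congr_fun measurableSet_Ioc fun t ht => hmerge t ht.1.le]
  exact hlim

end WeakForm

end Torus

end Literature.Analysis.FluidPDE

end
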